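/-
Copyright (c) 2026. All rights reserved.
Released under Apache 2.0 license as described in the file LICENSE.
Authors: abc-iut cell, prover seat abc-iut-f-196 (F fact-proving wave, tranche 196), over the statements of
abc-iut-L5-t4 (`ThetaPMEllHodgeTheatersF.lean`) and the witness kits of abc-iut-L5-t3 / abc-iut-L5-t4.
-/
import Literature.IUT.HodgeTheaters.ThetaPMEllHodgeTheatersFProofs
import Literature.IUT.HodgeTheaters.FKitCoreBridgeWitness
import Literature.IUT.HodgeTheaters.FPrimeStripsRigidity
import Literature.IUT.HodgeTheaters.PMBaseBridgePropsProofs8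
import Literature.IUT.HodgeTheaters.PMBaseNegCompatSub
import HarnessLib

/-!
# [IUTchI] Cor 6.12 (i)/(ii), Rmk 6.12.1 at the `ℱ`-level: the INSTANCE FORMS of `Cor612iF`,
# `GluingTorsorF`, `FunctorialDynamicsPMF` PROVED at the named witness `ℱ`-kits (proof-only)

S. Mochizuki, *Inter-universal Teichmüller theory I*, kurims manuscript (May 2020), §6: Cor 6.12 (i), (ii)
p. 173 ("follow[s] immediately from Definition 6.11; Corollary 5.3, (ii) [cf. also Proposition 6.6, (iv),
in the case of assertion (ii)]"), Rmk 6.12.1 p. 174 [claim: Mochizuki2012, status: disputed].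

PROOF-ONLY companion (theorems only: no `def`, no `structure`, no `instance`) of abc-iut-L5-t4's
`ThetaPMEllHodgeTheatersF.lean`, FACT-LIST rows F-2605 `PMBaseKit.FKit.Cor612iF`, F-2607
`PMBaseKit.FKit.GluingTorsorF`, F-2608 `PMBaseKit.FKit.FunctorialDynamicsPMF`.  State of these rows in the
tree before this file (R5 pattern, schema over the abstract `ℱ`-kit `FK : K.FKit M` of Def 5.2):

* universal closures over ALL kits REFUTED at the "fat" kit (abc-iut-f-028,
  `ThetaPMEllHodgeTheatersFClosures.lean`: `not_forall_cor612iF`, `not_forall_gluingTorsorF`,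
  `not_forall_functorialDynamicsPMF`), and `Cor612iF ↔ IsomFtoDBijective` over every kit
  (`ThetaPMEllHodgeTheatersFConverse.lean`);
* CONDITIONAL closers under Cor 5.3 (ii) `FKit.IsomFtoDBijective` by name (abc-iut-L5-t4:
  `cor612iF_of_isomFtoDBijective`, `gluingTorsorF_of_isomFtoDBijective` — its Prop 6.6 (iv) input since
  DISCHARGED, `DThetaPMBridge.gluingTorsor` — and `functorialDynamicsPMF_of_isomFtoDBijective`, whose second
  input is the `𝒟`-level symmetry of Prop 6.8 (i) `DThetaPMEllHT.EllBridgeSymmetry`, itself proved from law (β)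
  `Ex63.NegCompatModel` by `DThetaPMEllHT.ellBridgeSymmetry_of_negCompatModel`).

This file lands the SECOND HALF of the R5 pattern — the instance forms PROVED, hypothesis-free, at the two
witness `ℱ`-kits the tree names:

* abc-iut-L5-t3's `FKit.ofBase K' M` over EVERY base kit `K'` and multiplicative kit `M` (the `ℱ`-data are the
  isomorphs of the `𝒟`-data; Cor 5.3 (ii) holds there, `isomFtoDBijective_ofBase`): `cor612iF_ofBase`,
  `gluingTorsorF_ofBase` UNCONDITIONAL; `functorialDynamicsPMF_ofBase_of_negCompatModel` under law (β) of the
  base kit only, hence UNCONDITIONAL over abc-iut-L5-t4's `toyKit` (`Ex63.negCompatModel_toyKit`):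
  `functorialDynamicsPMF_ofBase_toyKit`;
* abc-iut-L5-t4's `FKit.toy l hl` over `toyKit l hl` / `MultKit.toy` (Cor 5.3 (ii) holds there, abc-iut-L5-d4's
  `isomFtoDBijective_toy`): `cor612iF_toy`, `gluingTorsorF_toy`, `functorialDynamicsPMF_toy` — all
  UNCONDITIONAL.

So each of the three rows now reads: «∀-closure REFUTED (fat kit) · PROVED at `FKit.ofBase` (every base kit;
Rmk 6.12.1 modulo law (β)) and at `FKit.toy` (unconditionally)».  HONEST LABEL: witness / toy kits, closed
terms; statements about the INTERFACE of Def 5.2, not about the genuine tempered Frobenioids.  Nothing of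
[IUTchI] is asserted; no side taken on [IUTchIII] Cor 3.12; typed ≠ proved.
-/

namespace Literature.IUT.HodgeTheaters

open CategoryTheory

universe u

namespace PMBaseKit

namespace FKit

variable {l : ℕ}

/-! ### At abc-iut-L5-t3's witness kit `FKit.ofBase K' M` (every base kit) -/

/-- **[IUTchI] Cor 6.12 (i)** (kurims p. 173), FACT-LIST row F-2605, INSTANCE FORM PROVED: over the witness
`ℱ`-kit `FKit.ofBase K' M` of ANY base kit `K'` (the `ℱ`-data are the isomorphs of the `𝒟`-data, so Cor 5.3 (ii)
holds: `isomFtoDBijective_ofBase`) the natural maps `IsoF.toD` are bijective for Θ^±-bridges, Θ^{ell}-bridges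
and Θ^{±ell}-Hodge theaters. [claim: Mochizuki2012, status: disputed] -/
theorem cor612iF_ofBase (K' : PMBaseKit.{u} l) (M : K'.MultKit) : (FKit.ofBase K' M).Cor612iF :=
  cor612iF_of_isomFtoDBijective (isomFtoDBijective_ofBase K' M)

/-- **[IUTchI] Cor 6.12 (ii)** (kurims p. 173), FACT-LIST row F-2607, INSTANCE FORM PROVED: over `FKit.ofBase K' M`
(ANY base kit `K'`) the `ℱ`-level gluing data between any Θ^±-bridge and any Θ^{ell}-bridge form an
`𝔽_l^{⋊±} × {±1}^𝕍`-torsor in the typed sense — from Cor 5.3 (ii) there (`isomFtoDBijective_ofBase`) and the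
DISCHARGED Prop 6.6 (iv) (`DThetaPMBridge.gluingTorsor`). [claim: Mochizuki2012, status: disputed] -/
theorem gluingTorsorF_ofBase (K' : PMBaseKit.{u} l) (M : K'.MultKit) (B : (FKit.ofBase K' M).ThetaPMBridge)
    (B' : (FKit.ofBase K' M).ThetaEllBridge) : (FKit.ofBase K' M).GluingTorsorF B B' :=
  gluingTorsorF_of_isomFtoDBijective (isomFtoDBijective_ofBase K' M) B B'
    (DThetaPMBridge.gluingTorsor B.dBridge B'.dBridge)

/-- **[IUTchI] Rmk 6.12.1** (kurims p. 174), FACT-LIST row F-2608, INSTANCE FORM: over `FKit.ofBase K' M` for a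
base kit `K'` satisfying law (β) `Ex63.NegCompatModel K'` (the `[−1]`-compatibility of Example 6.3 (ii), from
which Prop 6.8 (i) `EllBridgeSymmetry` is proved), the `ℱ`-level `𝔽_l^{⋊±}`-symmetry holds: the isomorphisms of
the Θ^{ell}-bridge of a Θ^{±ell}-Hodge theater act transitively on `T` and number `2·|T|`.
[claim: Mochizuki2012, status: disputed] -/
theorem functorialDynamicsPMF_ofBase_of_negCompatModel (K' : PMBaseKit.{u} l) (M : K'.MultKit)
    (hβ : Ex63.NegCompatModel K') : (FKit.ofBase K' M).FunctorialDynamicsPMF :=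
  functorialDynamicsPMF_of_isomFtoDBijective (isomFtoDBijective_ofBase K' M)
    fun H => DThetaPMEllHT.ellBridgeSymmetry_of_negCompatModel hβ H.dHT

/-- **[IUTchI] Rmk 6.12.1** (kurims p. 174), row F-2608, INSTANCE FORM PROVED UNCONDITIONALLY: over the witness
kit `FKit.ofBase (toyKit l hl) M` of abc-iut-L5-t4's toy base kit (prime `l ≠ 2`; law (β) holds there,
`Ex63.negCompatModel_toyKit`), for ANY multiplicative kit `M`. [claim: Mochizuki2012, status: disputed] -/
theorem functorialDynamicsPMF_ofBase_toyKit (l : ℕ) [Fact l.Prime] (hl : l ≠ 2)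
    (M : (toyKit l hl).MultKit) : (FKit.ofBase (toyKit l hl) M).FunctorialDynamicsPMF :=
  functorialDynamicsPMF_ofBase_of_negCompatModel (toyKit l hl) M (Ex63.negCompatModel_toyKit l hl)

/-! ### At abc-iut-L5-t4's toy kit `FKit.toy l hl` -/

/-- **[IUTchI] Cor 6.12 (i)** (kurims p. 173), row F-2605, INSTANCE FORM PROVED UNCONDITIONALLY at the toy
`ℱ`-kit `FKit.toy l hl` (Cor 5.3 (ii) holds there: abc-iut-L5-d4's `isomFtoDBijective_toy`).
[claim: Mochizuki2012, status: disputed] -/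
theorem cor612iF_toy (l : ℕ) [Fact l.Prime] (hl : l ≠ 2) : (FKit.toy l hl).Cor612iF :=
  cor612iF_of_isomFtoDBijective (isomFtoDBijective_toy l hl)

/-- **[IUTchI] Cor 6.12 (ii)** (kurims p. 173), row F-2607, INSTANCE FORM PROVED UNCONDITIONALLY at `FKit.toy l hl`
(Cor 5.3 (ii) `isomFtoDBijective_toy` + discharged Prop 6.6 (iv) `DThetaPMBridge.gluingTorsor`).
[claim: Mochizuki2012, status: disputed] -/
theorem gluingTorsorF_toy (l : ℕ) [Fact l.Prime] (hl : l ≠ 2) (B : (FKit.toy l hl).ThetaPMBridge)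
    (B' : (FKit.toy l hl).ThetaEllBridge) : (FKit.toy l hl).GluingTorsorF B B' :=
  gluingTorsorF_of_isomFtoDBijective (isomFtoDBijective_toy l hl) B B'
    (DThetaPMBridge.gluingTorsor B.dBridge B'.dBridge)

/-- **[IUTchI] Rmk 6.12.1** (kurims p. 174), row F-2608, INSTANCE FORM PROVED UNCONDITIONALLY at `FKit.toy l hl`
(Cor 5.3 (ii) `isomFtoDBijective_toy`; Prop 6.8 (i) from law (β) at the toy base kit,
`Ex63.negCompatModel_toyKit`). [claim: Mochizuki2012, status: disputed] -/
theorem functorialDynamicsPMF_toy (l : ℕ) [Fact l.Prime] (hl : l ≠ 2) : (FKit.toy l hl).FunctorialDynamicsPMF :=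
  functorialDynamicsPMF_of_isomFtoDBijective (isomFtoDBijective_toy l hl)
    fun H => DThetaPMEllHT.ellBridgeSymmetry_of_negCompatModel (Ex63.negCompatModel_toyKit l hl) H.dHT

/-! ### The three rows together, at each witness kit -/

/-- **[IUTchI] Cor 6.12 (i), (ii), Rmk 6.12.1 at `FKit.ofBase`** (rows F-2605/F-2607/F-2608 jointly): for every
base kit `K'` satisfying law (β) and every multiplicative kit `M`, all three named `ℱ`-level statements hold at
the witness kit `FKit.ofBase K' M`. [claim: Mochizuki2012, status: disputed] -/
theorem cor612_rmk6121_ofBase_of_negCompatModel (K' : PMBaseKit.{u} l) (M : K'.MultKit)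
    (hβ : Ex63.NegCompatModel K') :
    (FKit.ofBase K' M).Cor612iF ∧ (∀ B B', (FKit.ofBase K' M).GluingTorsorF B B') ∧
      (FKit.ofBase K' M).FunctorialDynamicsPMF :=
  ⟨cor612iF_ofBase K' M, gluingTorsorF_ofBase K' M, functorialDynamicsPMF_ofBase_of_negCompatModel K' M hβ⟩

/-- **[IUTchI] Cor 6.12 (i), (ii), Rmk 6.12.1 at `FKit.toy`** (rows F-2605/F-2607/F-2608 jointly, UNCONDITIONAL):
all three named `ℱ`-level statements hold at abc-iut-L5-t4's toy `ℱ`-kit (prime `l ≠ 2`) — the rows are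
jointly satisfiable exactly as typed. [claim: Mochizuki2012, status: disputed] -/
theorem cor612_rmk6121_toy (l : ℕ) [Fact l.Prime] (hl : l ≠ 2) :
    (FKit.toy l hl).Cor612iF ∧ (∀ B B', (FKit.toy l hl).GluingTorsorF B B') ∧
      (FKit.toy l hl).FunctorialDynamicsPMF :=
  ⟨cor612iF_toy l hl, gluingTorsorF_toy l hl, functorialDynamicsPMF_toy l hl⟩

/-! ### Row F-2604: `IsoFToDBijective` (all three twins) at the witness kits — the components of Cor 6.12 (i) -/

/-- **[IUTchI] Cor 6.12 (i), Θ^±-bridges** (kurims p. 173), FACT-LIST row F-2604, INSTANCE FORM PROVED at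
`FKit.ofBase K' M` for EVERY base kit `K'` (first component of `cor612iF_ofBase`).
[claim: Mochizuki2012, status: disputed] -/
theorem thetaPMBridge_isoFToDBijective_ofBase (K' : PMBaseKit.{u} l) (M : K'.MultKit)
    (B₁ B₂ : (FKit.ofBase K' M).ThetaPMBridge) : ThetaPMBridge.IsoFToDBijective B₁ B₂ :=
  (cor612iF_ofBase K' M).1 B₁ B₂

/-- **[IUTchI] Cor 6.12 (i), Θ^{ell}-bridges** (kurims p. 173), row F-2604, INSTANCE FORM PROVED at `FKit.ofBase K' M`
for EVERY base kit `K'`. [claim: Mochizuki2012, status: disputed] -/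
theorem thetaEllBridge_isoFToDBijective_ofBase (K' : PMBaseKit.{u} l) (M : K'.MultKit)
    (B₁ B₂ : (FKit.ofBase K' M).ThetaEllBridge) : ThetaEllBridge.IsoFToDBijective B₁ B₂ :=
  (cor612iF_ofBase K' M).2.1 B₁ B₂

/-- **[IUTchI] Cor 6.12 (i), Θ^{±ell}-Hodge theaters** (kurims p. 173), row F-2604, INSTANCE FORM PROVED at
`FKit.ofBase K' M` for EVERY base kit `K'`. [claim: Mochizuki2012, status: disputed] -/
theorem thetaPMEllHT_isoFToDBijective_ofBase (K' : PMBaseKit.{u} l) (M : K'.MultKit)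
    (H₁ H₂ : (FKit.ofBase K' M).ThetaPMEllHT) : ThetaPMEllHT.IsoFToDBijective H₁ H₂ :=
  (cor612iF_ofBase K' M).2.2 H₁ H₂

/-- **[IUTchI] Cor 6.12 (i), Θ^±-bridges** (kurims p. 173), row F-2604, INSTANCE FORM PROVED UNCONDITIONALLY at the
toy `ℱ`-kit `FKit.toy l hl`. [claim: Mochizuki2012, status: disputed] -/
theorem thetaPMBridge_isoFToDBijective_toy (l : ℕ) [Fact l.Prime] (hl : l ≠ 2)
    (B₁ B₂ : (FKit.toy l hl).ThetaPMBridge) : ThetaPMBridge.IsoFToDBijective B₁ B₂ :=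
  (cor612iF_toy l hl).1 B₁ B₂

/-- **[IUTchI] Cor 6.12 (i), Θ^{ell}-bridges** (kurims p. 173), row F-2604, INSTANCE FORM PROVED UNCONDITIONALLY at
`FKit.toy l hl`. [claim: Mochizuki2012, status: disputed] -/
theorem thetaEllBridge_isoFToDBijective_toy (l : ℕ) [Fact l.Prime] (hl : l ≠ 2)
    (B₁ B₂ : (FKit.toy l hl).ThetaEllBridge) : ThetaEllBridge.IsoFToDBijective B₁ B₂ :=
  (cor612iF_toy l hl).2.1 B₁ B₂

/-- **[IUTchI] Cor 6.12 (i), Θ^{±ell}-Hodge theaters** (kurims p. 173), row F-2604, INSTANCE FORM PROVED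
UNCONDITIONALLY at `FKit.toy l hl`. [claim: Mochizuki2012, status: disputed] -/
theorem thetaPMEllHT_isoFToDBijective_toy (l : ℕ) [Fact l.Prime] (hl : l ≠ 2)
    (H₁ H₂ : (FKit.toy l hl).ThetaPMEllHT) : ThetaPMEllHT.IsoFToDBijective H₁ H₂ :=
  (cor612iF_toy l hl).2.2 H₁ H₂

end FKit

end PMBaseKit

end Literature.IUT.HodgeTheaters
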